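import Literature.NumberTheory.GaloisRepresentations.LocalDualityTwoZero
import Literature.NumberTheory.EllipticCurves.ZpExtensionEisensteinOrdinaryInvariantsBoundProofs
import HarnessLib

/-!
# `H²(F, L) = 0` for a twisted `A_{m,ℓ}`-line `L = A_{m,ℓ} · b` over a local field when the residual character of `b`
# differs from the cyclotomic character (theorems only)

`Proofs` file (theorems only; no definition, no named fact, no instance, no `sorry`).  Topic `NumberTheory/EllipticCurves`
(cell `pub/bsd-print-x9`, memo `HOME/x9-p1-w3/H5B-AT-P-PLAN-w3g5.md`, file V4b: the `H² = 0` input of the lifting lemmas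
`Tower.exists_mem_strictSubgroup_map_eq_of_subsingleton_kernel` (x9-p1-w3, V4a) and
`Tower.exists_mem_strictSubgroup_map_eq_of_subsingleton` (x10b-p1-w6) for Howard's `F_𝔮` at `v ∣ p`).

Setting: `F` a non-archimedean local field of characteristic `0`, `A = A_{m,ℓ}` (`m, ℓ ≥ 1`), a finite discrete `A`-module `V`
on which `Γ_F` acts `A`-linearly (the Eisenstein twists `M ⊗ A_{m,ℓ}(ψ)`), a vector `b ∈ V` on which `Γ_F` acts through
`τ(g) b = u(g) • b` with `u(g) ≡ χ(g) (mod [T])` for natural numbers `χ(g)` (for `b = 1 ⊗ P`, `P` a generator of the ordinary line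
`Fil_v E[p^ℓ]`: `u = ψ χ⁺`, `ψ ≡ 1 (mod [T])`), and the `Γ_F`-stable cyclic line `L = A · b`.
* §1 **`eq_zero_of_equivariant_of_line`** — every additive `Γ_F`-equivariant `f : L → μ_{p^ℓ}` vanishes as soon as some
  `g₁ ∈ Γ_F` has `g₁ − χ(g₁)` injective on `μ_{p^ℓ}[p]` (NON-ANOMALOUS: `χ̄ ≠ ω̄`): downward induction on the `[T]`-adic
  filtration `[T]^i A b` of the line (`p = −[T]^m` pushes `p • y` one step down; `u(g₁) − χ(g₁) ∈ ([T])` does the same).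
* §2 **`subsingleton_galoisCohomology_two_line`** — hence `H²(F, L) = 0`, by local Tate duality in bidegree `(2,0)`
  (`ContinuousRep.natCard_two_eq_natCard_invariants_homRep`: `|H²(F, L)| = |Hom_{Γ_F}(L, μ_{p^ℓ})|`).
No summit statement is proved; BSD is not proved by any of this.  Seat `bsd-line-x9-p1-w3` g5.

References: [Howard2004HeegnerKolyvagin] §3.1–3.2 (arXiv:1202.6340 p. 15 L56–66, p. 16 L5–6); [SerreGaloisCohomology1997]
II §5.2 Thm. 2; [MilneADT2006] I Cor. 2.3; [GreenbergLNM1716] §2.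
-/

set_option autoImplicit false

noncomputable section

open Function Field

namespace Literature.NumberTheory.EllipticCurves.ZpExtension

open Literature.NumberTheory.GaloisRepresentations Literature.NumberTheory.EllipticCurves.IwasawaAlgebra
open Literature.NumberTheory.GaloisRepresentations.DiscreteGaloisModule (MuCarrier mu)

variable {F : Type} [Field F] {p : ℕ} [hp : Fact p.Prime] {m ℓ : ℕ}
  {V : Type} [AddCommGroup V] [Module (EisensteinCoeff p m ℓ) V] [TopologicalSpace V] [DiscreteTopology V]
  (τ : DiscreteGaloisModule F V)

/-! ## §1 Equivariant maps from a twisted `A_{m,ℓ}`-line to `μ_{p^ℓ}` vanish -/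

/-- **Every `Γ_F`-equivariant additive map `f : A_{m,ℓ} · b → μ_{p^ℓ}` vanishes** when `Γ_F` acts `A`-linearly on `V`,
`τ(g) b = u(g) • b` with `u(g) ≡ χ(g) (mod [T])`, and some `g₁` has `g₁ − χ(g₁)` injective on the `p`-torsion of `μ_{p^ℓ}`
(the residual character of the line differs from the cyclotomic character — the non-anomalous case for `Fil_v E[p]`).
Downward induction on `i` in `f([T]^i A b) = 0`. [cite: Howard2004HeegnerKolyvagin, §3.1–3.2 (arXiv p. 15 L62–66, p. 16 L5–6)]
[cite: GreenbergLNM1716, §2] -/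
theorem eq_zero_of_equivariant_of_line (hm : 1 ≤ m) {Ω : Type} [AddCommGroup Ω] (ω : absoluteGaloisGroup F → Ω →+ Ω)
    (hlin : ∀ (g : absoluteGaloisGroup F) (c : EisensteinCoeff p m ℓ) (x : V), τ g (c • x) = c • τ g x)
    (b : V) (u : absoluteGaloisGroup F → EisensteinCoeff p m ℓ) (hb : ∀ g, τ g b = u g • b)
    (χ : absoluteGaloisGroup F → ℕ)
    (hu : ∀ g, u g - (χ g : EisensteinCoeff p m ℓ) ∈ Ideal.span {(Ideal.Quotient.mk _ PowerSeries.X : EisensteinCoeff p m ℓ)})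
    (S : Submodule ℤ V) (hS : ∀ c : EisensteinCoeff p m ℓ, c • b ∈ S)
    (hna : ∃ g₁ : absoluteGaloisGroup F, ∀ z : Ω, p • z = 0 → ω g₁ z = χ g₁ • z → z = 0)
    (f : S →+ Ω) (hf : ∀ (g : absoluteGaloisGroup F) (c : EisensteinCoeff p m ℓ),
      f ⟨τ g (c • b), by rw [hlin, hb, smul_smul]; exact hS _⟩ = ω g (f ⟨c • b, hS c⟩))
    (c : EisensteinCoeff p m ℓ) : f ⟨c • b, hS c⟩ = 0 := by
  obtain ⟨g₁, hg₁⟩ := hna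
  set π : EisensteinCoeff p m ℓ := Ideal.Quotient.mk _ PowerSeries.X with hπ
  -- the parametrisation of the line
  let sb : EisensteinCoeff p m ℓ → S := fun c ↦ ⟨c • b, hS c⟩
  have sb_add : ∀ c c', sb (c + c') = sb c + sb c' := fun c c' ↦ Subtype.ext (add_smul c c' b)
  have sb_nat : ∀ (n : ℕ) c, sb ((n : EisensteinCoeff p m ℓ) * c) = n • sb c := fun n c ↦
    Subtype.ext (by
      change ((n : EisensteinCoeff p m ℓ) * c) • b = ((n • sb c : S) : V)
      rw [AddSubmonoidClass.coe_nsmul, mul_smul, Nat.cast_smul_eq_nsmul])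
  change f (sb c) = 0
  -- downward induction: `f (sb (π^i c)) = 0` for all `c`
  suffices h : ∀ i c, m * ℓ - i ≤ m * ℓ → f (sb (π ^ (m * ℓ - i) * c)) = 0 by
    have := h (m * ℓ) c (Nat.sub_le _ _)
    rwa [Nat.sub_self, pow_zero, one_mul] at this
  intro i
  induction i with
  | zero =>
    intro c _
    have h0 : sb (π ^ (m * ℓ - 0) * c) = 0 :=
      Subtype.ext (by change (π ^ (m * ℓ - 0) * c) • b = 0
                      rw [Nat.sub_zero, EisensteinCoeff.mk_X_pow_mul_eq_zero, zero_mul, zero_smul])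
    rw [h0, map_zero]
  | succ i ih =>
    intro c hi
    by_cases hle : m * ℓ ≤ i
    · have h1 : m * ℓ - (i + 1) = m * ℓ - i := by omega
      rw [h1]; exact ih c (by omega)
    · set e := m * ℓ - (i + 1) with he
      have he1 : m * ℓ - i = e + 1 := by omega
      have IH : ∀ d : EisensteinCoeff p m ℓ, f (sb (π ^ (e + 1) * d)) = 0 := fun d ↦ by
        rw [← he1]; exact ih d (by omega)
      -- (a) `p • f y = 0`
      have hpy : p • f (sb (π ^ e * c)) = 0 := by
        rw [← map_nsmul, ← sb_nat, EisensteinCoeff.natCast_eq_neg_mk_X_pow p m ℓ]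
        have h2 : -π ^ m * (π ^ e * c) = π ^ (e + 1) * (-(π ^ (m - 1) * c)) := by
          rw [mul_neg, neg_mul, ← mul_assoc, ← mul_assoc, ← pow_add, ← pow_add]
          congr 3; omega
        rw [h2]; exact IH _
      -- (b) `f (g₁ y) = χ g₁ • f y`
      obtain ⟨d, hd⟩ := Ideal.mem_span_singleton'.mp (hu g₁)
      have hu1 : u g₁ = (χ g₁ : EisensteinCoeff p m ℓ) + d * π := by rw [← sub_eq_iff_eq_add', hd]
      have hdec : (⟨τ g₁ ((π ^ e * c) • b), by rw [hlin, hb, smul_smul]; exact hS _⟩ : S) =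
          sb ((χ g₁ : EisensteinCoeff p m ℓ) * (π ^ e * c)) + sb (π ^ (e + 1) * (d * c)) := by
        rw [← sb_add]
        apply Subtype.ext
        change τ g₁ ((π ^ e * c) • b) = ((χ g₁ : EisensteinCoeff p m ℓ) * (π ^ e * c) + π ^ (e + 1) * (d * c)) • b
        rw [hlin, hb, smul_smul, hu1]
        congr 1; ring
      have hgy : f ⟨τ g₁ ((π ^ e * c) • b), by rw [hlin, hb, smul_smul]; exact hS _⟩ = χ g₁ • f (sb (π ^ e * c)) := by
        rw [hdec, map_add, IH, add_zero, sb_nat, map_nsmul]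
      have hω : ω g₁ (f (sb (π ^ e * c))) = χ g₁ • f (sb (π ^ e * c)) := by rw [← hgy, hf]
      exact hg₁ _ hpy hω

/-! ## §2 `H²(F, A_{m,ℓ} · b) = 0` -/

/-- **`H²(F, L) = 0` for the twisted line `L = A_{m,ℓ} · b`** over a non-archimedean local field `F` of characteristic `0`,
when the residual character of `b` differs from the cyclotomic character on `μ_{p^ℓ}[p]` (non-anomalous case): local Tate
duality `|H²(F, L)| = |Hom_{Γ_F}(L, μ_{p^ℓ})|` and §1. [cite: SerreGaloisCohomology1997, II §5.2 Thm. 2] [cite: MilneADT2006, I Cor. 2.3]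
[cite: Howard2004HeegnerKolyvagin, §3.1–3.2 (arXiv p. 15 L62–66, p. 16 L5–6)] -/
theorem subsingleton_galoisCohomology_two_line {F : Type} [Field F] [ValuativeRel F] [TopologicalSpace F]
    [IsNonarchimedeanLocalField F] [CharZero F] {V : Type} [AddCommGroup V] [Module (EisensteinCoeff p m ℓ) V]
    [TopologicalSpace V] [DiscreteTopology V] [Finite V] (τ : DiscreteGaloisModule F V) (hm : 1 ≤ m)
    (hlin : ∀ (g : absoluteGaloisGroup F) (c : EisensteinCoeff p m ℓ) (x : V), τ g (c • x) = c • τ g x)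
    (b : V) (u : absoluteGaloisGroup F → EisensteinCoeff p m ℓ) (hb : ∀ g, τ g b = u g • b)
    (χ : absoluteGaloisGroup F → ℕ)
    (hu : ∀ g, u g - (χ g : EisensteinCoeff p m ℓ) ∈ Ideal.span {(Ideal.Quotient.mk _ PowerSeries.X : EisensteinCoeff p m ℓ)})
    (S : Submodule ℤ V) (hS : ∀ x, x ∈ S ↔ ∃ c : EisensteinCoeff p m ℓ, x = c • b)
    (hSstab : ∀ g : absoluteGaloisGroup F, S ≤ S.comap (τ g))
    (hna : ∃ g₁ : absoluteGaloisGroup F, ∀ z : MuCarrier F (p ^ ℓ), p • z = 0 → mu F (p ^ ℓ) g₁ z = χ g₁ • z → z = 0) :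
    Subsingleton (galoisCohomology (τ.subrepresentation S hSstab) 2) := by
  have hSc : ∀ c : EisensteinCoeff p m ℓ, c • b ∈ S := fun c ↦ (hS _).mpr ⟨c, rfl⟩
  have hM : ∀ x : S, p ^ ℓ • x = 0 := fun x ↦ Subtype.ext (by
    rw [AddSubmonoidClass.coe_nsmul, ZeroMemClass.coe_zero, ← natCast_zsmul, Nat.cast_pow]
    exact EisensteinCoeff.natCast_pow_smul_eq_zero m ℓ (x : V))
  obtain ⟨hfin, hcard⟩ := natCard_two_eq_natCard_invariants_homRep F (τ.subrepresentation S hSstab) hM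
  haveI := hfin
  -- every invariant of `Hom(L, μ)` vanishes
  have hinv : ∀ φ ∈ ((τ.subrepresentation S hSstab).homRep (mu F (p ^ ℓ))).toTopRep.ρ.invariants, φ = 0 := by
    intro φ hφ
    have heq : ∀ (g : absoluteGaloisGroup F) (x : S), mu F (p ^ ℓ) g (φ x) = φ ((τ.subrepresentation S hSstab) g x) :=
      fun g ↦ ((τ.subrepresentation S hSstab).homRep_apply_eq_self_iff (mu F (p ^ ℓ)) g φ).mp (hφ g)
    have hzero : ∀ c : EisensteinCoeff p m ℓ, (φ : S →+ MuCarrier F (p ^ ℓ)) ⟨c • b, hSc c⟩ = 0 :=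
      eq_zero_of_equivariant_of_line τ hm (fun g ↦ (mu F (p ^ ℓ) g : MuCarrier F (p ^ ℓ) →+ MuCarrier F (p ^ ℓ)))
        hlin b u hb χ hu S hSc hna φ (fun g c ↦ (heq g ⟨c • b, hSc c⟩).symm)
    refine HomCarrier.ext fun x ↦ ?_
    obtain ⟨c, hc⟩ := (hS x).mp x.2
    have hx : x = ⟨c • b, hSc c⟩ := Subtype.ext hc
    rw [hx]
    exact hzero c
  have h1 : Nat.card ((τ.subrepresentation S hSstab).homRep (mu F (p ^ ℓ))).toTopRep.ρ.invariants = 1 := by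
    rw [Nat.card_eq_one_iff_exists]
    exact ⟨0, fun φ ↦ Subtype.ext (hinv φ φ.2)⟩
  rw [h1] at hcard
  exact (Nat.card_eq_one_iff_unique.mp hcard).1

end Literature.NumberTheory.EllipticCurves.ZpExtension


end
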